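import Literature.MathematicalPhysics.QuantumManyBody.PeriodicClusteringFromKyFanGap
import HarnessLib

/-!
# The kinetic energy of a multiplied wave function: `|∇(χψ)|² ≤ (1+θ)χ²|∇ψ|² + (1+θ⁻¹)|ψ|²|∇χ|²`

Topic `Literature/MathematicalPhysics/QuantumManyBody`; companion of `PeriodicBoseGas.lean`. For an `N`-body wave
function `ψ : (ℝ³)^N → ℂ` and a REAL multiplier `χ : (ℝ³)^N → ℝ` (a cut-off), both differentiable at `X`, and every
`θ > 0`, the kinetic density of the product obeys the pointwise IMS/Young bound

  `kineticDensity (χψ) X ≤ (1+θ) χ(X)² · kineticDensity ψ X + (1+θ⁻¹) |ψ(X)|² · kineticDensity χ X`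

(`kineticDensity_ofReal_mul_le`; `kineticDensity χ` is read through the complexification `X ↦ (χ X : ℂ)`, i.e.
`∑_{i,k} |∂_{ik}χ|²`), and hence the integrated bound on any set (`setLIntegral_kineticDensity_ofReal_mul_le`). This is
the analytic core of every cut-off construction (removing a hard-core shell from a minimiser, localising into a box):
the product rule `∂(χψ) = χ∂ψ + ψ∂χ` and `|a+b|² ≤ (1+θ)|a|² + (1+θ⁻¹)|b|²`. [LSSY2005, proof of Thm 2.4 (box
localisation); CyconFroeseKirschSimon1987, §3.1 (IMS localisation formula)]
-/

noncomputable section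

open MeasureTheory
open scoped ENNReal NNReal

namespace Literature.MathematicalPhysics.QuantumManyBody.BoseGas

variable {N : ℕ}

/-- Young's inequality for a sum of two vectors: `‖a + b‖² ≤ (1+θ)‖a‖² + (1+θ⁻¹)‖b‖²` (`θ > 0`). [folklore] -/
theorem norm_add_sq_le_young {E : Type*} [SeminormedAddCommGroup E] (a b : E) {θ : ℝ} (hθ : 0 < θ) :
    ‖a + b‖ ^ 2 ≤ (1 + θ) * ‖a‖ ^ 2 + (1 + θ⁻¹) * ‖b‖ ^ 2 := by
  have h1 : ‖a + b‖ ^ 2 ≤ (‖a‖ + ‖b‖) ^ 2 :=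
    pow_le_pow_left₀ (norm_nonneg _) (norm_add_le a b) 2
  -- `2‖a‖‖b‖ ≤ θ‖a‖² + θ⁻¹‖b‖²`
  have h2 : 2 * ‖a‖ * ‖b‖ ≤ θ * ‖a‖ ^ 2 + θ⁻¹ * ‖b‖ ^ 2 := by
    have hsq : 0 ≤ θ * (‖a‖ - θ⁻¹ * ‖b‖) ^ 2 := by positivity
    have hid : θ * (‖a‖ - θ⁻¹ * ‖b‖) ^ 2 = θ * ‖a‖ ^ 2 - 2 * ‖a‖ * ‖b‖ + θ⁻¹ * ‖b‖ ^ 2 := by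
      field_simp
      ring
    linarith
  nlinarith [h1, h2]

/-- **Pointwise kinetic bound for a real multiplier.** For `ψ : (ℝ³)^N → ℂ` and `χ : (ℝ³)^N → ℝ` differentiable at
`X` and `θ > 0`:
`kineticDensity (χψ) X ≤ (1+θ) χ(X)² kineticDensity ψ X + (1+θ⁻¹) |ψ X|² kineticDensity χ X`. [folklore] -/
theorem kineticDensity_ofReal_mul_le {ψ : Config N → ℂ} {χ : Config N → ℝ} {X : Config N}
    (hψ : DifferentiableAt ℝ ψ X) (hχ : DifferentiableAt ℝ χ X) {θ : ℝ} (hθ : 0 < θ) :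
    kineticDensity (fun Y => (χ Y : ℂ) * ψ Y) X ≤
      ENNReal.ofReal ((1 + θ) * χ X ^ 2) * kineticDensity ψ X +
        ENNReal.ofReal (1 + θ⁻¹) * (‖ψ X‖₊ : ℝ≥0∞) ^ 2 * kineticDensity (fun Y => (χ Y : ℂ)) X := by
  -- the complexified multiplier and the product rule
  have hχc : DifferentiableAt ℝ (fun Y => (χ Y : ℂ)) X := Complex.ofRealCLM.differentiableAt.comp X hχ
  have hprod : fderiv ℝ (fun Y => (χ Y : ℂ) * ψ Y) X =
      (χ X : ℂ) • fderiv ℝ ψ X + ψ X • fderiv ℝ (fun Y => (χ Y : ℂ)) X :=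
    (hχc.hasFDerivAt.mul hψ.hasFDerivAt).fderiv
  unfold kineticDensity
  rw [Finset.mul_sum, Finset.mul_sum, ← Finset.sum_add_distrib]
  refine Finset.sum_le_sum fun i _ => ?_
  rw [Finset.mul_sum, Finset.mul_sum, ← Finset.sum_add_distrib]
  refine Finset.sum_le_sum fun k _ => ?_
  set e : Config N := Pi.single i (EuclideanSpace.single k (1 : ℝ)) with he
  set a : ℂ := (χ X : ℂ) * fderiv ℝ ψ X e with ha
  set b : ℂ := ψ X * fderiv ℝ (fun Y => (χ Y : ℂ)) X e with hb
  have hab : fderiv ℝ (fun Y => (χ Y : ℂ) * ψ Y) X e = a + b := by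
    rw [hprod]; simp [ha, hb, smul_eq_mul]
  have hy := norm_add_sq_le_young a b hθ
  -- rewrite everything as `ofReal` of real squares
  have hsq : ∀ z : ℂ, ((‖z‖₊ : ℝ≥0∞)) ^ 2 = ENNReal.ofReal (‖z‖ ^ 2) := fun z => by
    rw [← ENNReal.coe_pow, ENNReal.ofReal, Real.toNNReal_pow (norm_nonneg _), norm_toNNReal]
  rw [hab, hsq, hsq, hsq, hsq]
  have hna : ‖a‖ ^ 2 = χ X ^ 2 * ‖fderiv ℝ ψ X e‖ ^ 2 := by
    rw [ha, norm_mul, mul_pow, Complex.norm_real, Real.norm_eq_abs, sq_abs]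
  have hnb : ‖b‖ ^ 2 = ‖ψ X‖ ^ 2 * ‖fderiv ℝ (fun Y => (χ Y : ℂ)) X e‖ ^ 2 := by
    rw [hb, norm_mul, mul_pow]
  have h0 : 0 ≤ (1 + θ) * χ X ^ 2 := by positivity
  have h1 : 0 ≤ 1 + θ⁻¹ := by positivity
  rw [← ENNReal.ofReal_mul h0, ← ENNReal.ofReal_mul h1, ← ENNReal.ofReal_mul (by positivity),
    ← ENNReal.ofReal_add (by positivity) (by positivity)]
  refine ENNReal.ofReal_le_ofReal ?_
  calc ‖a + b‖ ^ 2 ≤ (1 + θ) * ‖a‖ ^ 2 + (1 + θ⁻¹) * ‖b‖ ^ 2 := hy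
    _ = (1 + θ) * χ X ^ 2 * ‖fderiv ℝ ψ X e‖ ^ 2 +
          (1 + θ⁻¹) * ‖ψ X‖ ^ 2 * ‖fderiv ℝ (fun Y => (χ Y : ℂ)) X e‖ ^ 2 := by rw [hna, hnb]; ring

/-- **Integrated kinetic bound for a real multiplier** on any set `S`: for `ψ`, `χ` differentiable everywhere and
`θ > 0`, `∫_S |∇(χψ)|² ≤ (1+θ) ∫_S χ²|∇ψ|² + (1+θ⁻¹) ∫_S |ψ|²|∇χ|²`. [folklore] -/
theorem setLIntegral_kineticDensity_ofReal_mul_le {ψ : Config N → ℂ} {χ : Config N → ℝ}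
    (hψ : Differentiable ℝ ψ) (hχ : Differentiable ℝ χ) {θ : ℝ} (hθ : 0 < θ) (S : Set (Config N)) :
    ∫⁻ X in S, kineticDensity (fun Y => (χ Y : ℂ) * ψ Y) X ≤
      ENNReal.ofReal (1 + θ) * (∫⁻ X in S, ENNReal.ofReal (χ X ^ 2) * kineticDensity ψ X) +
        ENNReal.ofReal (1 + θ⁻¹) *
          (∫⁻ X in S, (‖ψ X‖₊ : ℝ≥0∞) ^ 2 * kineticDensity (fun Y => (χ Y : ℂ)) X) := by
  calc ∫⁻ X in S, kineticDensity (fun Y => (χ Y : ℂ) * ψ Y) X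
      ≤ ∫⁻ X in S, ENNReal.ofReal (1 + θ) * (ENNReal.ofReal (χ X ^ 2) * kineticDensity ψ X) +
          ENNReal.ofReal (1 + θ⁻¹) * ((‖ψ X‖₊ : ℝ≥0∞) ^ 2 * kineticDensity (fun Y => (χ Y : ℂ)) X) := by
        refine lintegral_mono fun X => ?_
        have h := kineticDensity_ofReal_mul_le (hψ X) (hχ X) hθ
        rw [ENNReal.ofReal_mul (by positivity : (0 : ℝ) ≤ 1 + θ)] at h
        simpa only [mul_assoc] using h
    _ = (∫⁻ X in S, ENNReal.ofReal (1 + θ) * (ENNReal.ofReal (χ X ^ 2) * kineticDensity ψ X)) +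
          ∫⁻ X in S, ENNReal.ofReal (1 + θ⁻¹) *
            ((‖ψ X‖₊ : ℝ≥0∞) ^ 2 * kineticDensity (fun Y => (χ Y : ℂ)) X) :=
        lintegral_add_left' (μ := volume.restrict S)
          (f := fun X => ENNReal.ofReal (1 + θ) * (ENNReal.ofReal (χ X ^ 2) * kineticDensity ψ X))
          (by exact (measurable_const.mul ((ENNReal.measurable_ofReal.comp
            ((continuous_pow 2).measurable.comp hχ.continuous.measurable)).mul
            (measurable_kineticDensity_of_any ψ))).aemeasurable) _
    _ = _ := by
        rw [lintegral_const_mul' _ _ ENNReal.ofReal_ne_top, lintegral_const_mul' _ _ ENNReal.ofReal_ne_top]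

/-- **A cut-off valued in `[0,1]` does not increase the mass**: `∫_S |χψ|² ≤ ∫_S |ψ|²`. [folklore] -/
theorem setLIntegral_nnnorm_ofReal_mul_sq_le {ψ : Config N → ℂ} {χ : Config N → ℝ}
    (hχ : ∀ X, 0 ≤ χ X ∧ χ X ≤ 1) (S : Set (Config N)) :
    ∫⁻ X in S, (‖(χ X : ℂ) * ψ X‖₊ : ℝ≥0∞) ^ 2 ≤ ∫⁻ X in S, (‖ψ X‖₊ : ℝ≥0∞) ^ 2 := by
  refine lintegral_mono fun X => ?_
  have h1 : ‖(χ X : ℂ) * ψ X‖₊ ≤ ‖ψ X‖₊ := by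
    rw [nnnorm_mul, ← NNReal.coe_le_coe, NNReal.coe_mul, coe_nnnorm, coe_nnnorm, Complex.norm_real,
      Real.norm_eq_abs, abs_of_nonneg (hχ X).1]
    exact mul_le_of_le_one_left (norm_nonneg _) (hχ X).2
  exact pow_le_pow_left' (ENNReal.coe_le_coe.2 h1) 2

/-- **The interaction of a cut state on the support of the cut-off**: where `χ` vanishes the interaction term of
`χψ` vanishes, whatever the potential (`⊤ · 0 = 0`): `W · |χψ|² ≤ W · 1_{χ ≠ 0} · |ψ|²` for `χ ∈ [0,1]`. [folklore] -/
theorem interaction_term_ofReal_mul_le {ψ : Config N → ℂ} {χ : Config N → ℝ}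
    (hχ : ∀ X, 0 ≤ χ X ∧ χ X ≤ 1) (W : Config N → ℝ≥0∞) (X : Config N) :
    W X * (‖(χ X : ℂ) * ψ X‖₊ : ℝ≥0∞) ^ 2 ≤
      {Y | χ Y ≠ 0}.indicator W X * (‖ψ X‖₊ : ℝ≥0∞) ^ 2 := by
  by_cases h0 : χ X = 0
  · simp [h0]
  · rw [Set.indicator_of_mem (by exact h0)]
    refine mul_le_mul' le_rfl ?_
    have h1 : ‖(χ X : ℂ) * ψ X‖₊ ≤ ‖ψ X‖₊ := by
      rw [nnnorm_mul, ← NNReal.coe_le_coe, NNReal.coe_mul, coe_nnnorm, coe_nnnorm, Complex.norm_real,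
        Real.norm_eq_abs, abs_of_nonneg (hχ X).1]
      exact mul_le_of_le_one_left (norm_nonneg _) (hχ X).2
    exact pow_le_pow_left' (ENNReal.coe_le_coe.2 h1) 2

end Literature.MathematicalPhysics.QuantumManyBody.BoseGas

end
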